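import Literature.NumberTheory.GelbartRogawski1991.DoubledKroneckerConjugation
import Literature.NumberTheory.GelbartRogawski1991.DoubledWeilRepresentationArchLagrangian
import Literature.NumberTheory.GelbartRogawski1991.DoubledWeilRepresentationLocalFamilyCM
import HarnessLib

/-!
# The doubled Kronecker conjugation datum (III): the undoubled side — `r = reindex_e r_{L⁺}(h₀)` at the Kronecker index, the
# negated partner `rneg` on `𝕎⁻`, the see-saw square `r_square`, and `π(undoubleIdx rD) = π(r) ⊕ π(rneg)`

Cell `hodgecm-mathlib`, GS-6 (β) glue, node (T) «frame independence of `ω(μ,ε,χ)`», piece (T1ᴰ) = the MODEL INSTANTIATION of the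
doubled conjugation datum (placement row L-13b, wave 2).  Phase-A bytes of record: `A-plan/gs6-glue/T1D-modelInstantiation.A-p06g11.lean`
v3 sha16 54c3fde381223f81 (A-p06 g11; heir A-p15 g8, v4 117472700602f9d5), declarations byte-identical up to (i) `[folklore]` → `[cite:]`
docstring tags and (ii) the local notations `𝔸⁺`/`𝔸L` expanded to `(AdeleRing (𝓞 (Fp L)) (Fp L))`/`(AdeleRing (𝓞 L) L)` (no notation in
Literature files).  HC_CM is proved only modulo the 7 printed citations until rung 0 closes.

THE MODEL.  CM field `L`, `L⁺ = Fp L`, frames `dV, dV′ : Fin N → L` (two hermitian structures on `V`), `dW : Fin M → L`, enumeration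
`e : Fin N × Fin M ≃ Fin n`; an adelic isometry `a : (V ⊗ 𝔸, diag dV′) ≅ (V ⊗ 𝔸, diag dV)` (`ha`), rational (`a = a₀ ⊗ 1`, `haa₀`), and a
relabelling `C ∈ GL_{N M}(𝔸_{L⁺})`, `(T_V ⊗ T_W) C = T_V′ ⊗ T_W` (`hC`), rational (`C = C₀ ⊗ 1`, `hCC₀`).

* §5 **`rKron := r_F(adelicSeesawConjLeft a C)`** (the element of ★ `UnitaryGroupSeesawConjugationLeft` at the Kronecker index) and
  **`r := reindex_e rKron ∈ Mp(𝕎)ᶜᵒⁿᵗ`** (`adelicMpContReindex_symm_r`, `proj_r`, `r_mem_adelicMpTheta`), **`r_square`** (the undoubled group-side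
  square over ★ `adelicSeesawConjLeft_conj_pair`), **`rneg := r_F(seesawNeg)`** on `𝕎⁻` (Gram `−gramA`; `seesawNeg_mem_range`, `proj_rneg`,
  `rneg_mem_adelicMpTheta`; over ★ `gramR_isSymm` / ★ `isUnit_det_gramR₀`), coordinates of `Λ⁻¹` (`relabC_inv_mulVec`, `relabCD_inv_mulVec`, `coe_proj_*_apply`), and
  **`proj_undoubleIdx_rD`**: `π(undoubleIdx rD) = π(r) ⊕ π(rneg)` — the hypotheses of «undoubling commutes with the rational-lift conjugation»
  (★ `DoubledWeilRepresentationUndoublingConjTransport.undouble_conjSplitting_comp`, `omega_undoubleIdx_tensorToSum_of_mem_adelicMpTheta`).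

## References

* [Kudla1984] S. Kudla, *Seesaw dual reductive pairs*, Progr. Math. 46 (1984), §1.
* [Kudla1994] S. S. Kudla, *Splitting metaplectic covers of dual reductive pairs*, Israel J. Math. 87 (1994), §2, Thm. 3.1.
* [GelbartRogawski1991] S. Gelbart, J. Rogawski, Invent. Math. 105 (1991), §3.1 p. 454, Prop. 3.1.1 p. 455.
* [Weil1964] A. Weil, Acta Math. 111 (1964), Chap. III n° 40 p. 190, n° 41 Thm 6 p. 193 (rational lifts fix `Θ`).
* [MoeglinVignerasWaldspurger1987] C. Mœglin, M.-F. Vignéras, J.-L. Waldspurger, LNM 1291 (1987), Chap. 2 II.1.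
* [PlatonovRapinchuk1994] V. Platonov, A. Rapinchuk, *Algebraic Groups and Number Theory* (1994), §2.3, §5.1.
-/

set_option autoImplicit false

noncomputable section

open scoped Classical
open scoped Matrix Kronecker
open NumberField IsDedekindDomain
open Literature.RepresentationTheory.HeisenbergGroup
open Literature.RepresentationTheory.HeisenbergGroup.SymplecticMatrix (transportSp mapHom)
open Literature.NumberTheory.Automorphic hiding reindexGL coe_reindexGL
open Literature.NumberTheory.Weil1964
open Literature.NumberTheory.GaloisRepresentations

namespace Literature.NumberTheory.GelbartRogawski1991.GRConstruction

open UnitaryDualPair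
open Literature.NumberTheory.Automorphic.UnitaryGroup

variable (L : Type) [Field L] [NumberField L] [IsCMField L]
  {N M n : ℕ} (e : Fin N × Fin M ≃ Fin n)
  (dV : Fin N → L) (hdV : ∀ i, IsCMField.complexConj L (dV i) = dV i) (hdV0 : ∀ i, dV i ≠ 0)
  (dV' : Fin N → L) (hdV' : ∀ i, IsCMField.complexConj L (dV' i) = dV' i) (hdV'0 : ∀ i, dV' i ≠ 0)
  (dW : Fin M → L) (hdW : ∀ i, IsCMField.complexConj L (dW i) = dW i) (hdW0 : ∀ i, dW i ≠ 0)

/-! # §5 The undoubled side: `r = reindex_e r_{L⁺}(h₀)`, `rneg`, (T4u)'s `hsq` and §B's `hπ` -/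

section Undoubled

omit [IsCMField L] in
/-- generic: relabelling by `reindexGL e C` after `spReindex e` is `spReindex e` after relabelling by `C`. [cite: MoeglinVignerasWaldspurger1987, Chap. 2 II.1] -/
theorem symplecticGroupCongr_relabelVec_spReindex {ι ι' : Type} [Fintype ι] [DecidableEq ι] [Fintype ι'] [DecidableEq ι']
    (eι : ι ≃ ι') {T T' : Matrix ι ι (AdeleRing (𝓞 (Fp L)) (Fp L))} (C : GL ι (AdeleRing (𝓞 (Fp L)) (Fp L))) (hC : T * (C : Matrix ι ι (AdeleRing (𝓞 (Fp L)) (Fp L))) = T')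
    (hC' : Matrix.reindex eι eι T * ((reindexGL eι C : GL ι' (AdeleRing (𝓞 (Fp L)) (Fp L))) : Matrix ι' ι' (AdeleRing (𝓞 (Fp L)) (Fp L))) = Matrix.reindex eι eι T')
    (X : symplecticGroup (polar (adelicForm (Fp L) ι T'))) :
    symplecticGroupCongr (polar (adelicForm (Fp L) ι' (Matrix.reindex eι eι T')))
        (polar (adelicForm (Fp L) ι' (Matrix.reindex eι eι T))) (relabelVec (Fp L) ι' (reindexGL eι C))
        (polar_relabelVec (Fp L) ι' (reindexGL eι C) hC') (spReindex eι T' X) =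
      spReindex eι T (symplecticGroupCongr (polar (adelicForm (Fp L) ι T')) (polar (adelicForm (Fp L) ι T))
        (relabelVec (Fp L) ι C) (polar_relabelVec (Fp L) ι C hC) X) := by
  have h1 : ∀ v : (ι' → (AdeleRing (𝓞 (Fp L)) (Fp L))) × (ι' → (AdeleRing (𝓞 (Fp L)) (Fp L))), (relabelVec (Fp L) ι' (reindexGL eι C)).symm v =
      reindexW (AdeleRing (𝓞 (Fp L)) (Fp L)) eι ((relabelVec (Fp L) ι C).symm ((reindexW (AdeleRing (𝓞 (Fp L)) (Fp L)) eι).symm v)) := fun v => by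
    refine Prod.ext (funext fun i => ?_) ?_
    · simp only [relabelVec_symm_apply, reindexW_apply, reindexW_symm_apply, Function.comp_apply, Equiv.apply_symm_apply]
    · simp only [relabelVec_symm_apply, reindexW_apply, reindexW_symm_apply, ← map_inv, coe_reindexGL, Matrix.reindex_apply,
        Matrix.submatrix_mulVec_equiv, Equiv.symm_symm]
  have h2 : ∀ w : (ι → (AdeleRing (𝓞 (Fp L)) (Fp L))) × (ι → (AdeleRing (𝓞 (Fp L)) (Fp L))), relabelVec (Fp L) ι' (reindexGL eι C) (reindexW (AdeleRing (𝓞 (Fp L)) (Fp L)) eι w) =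
      reindexW (AdeleRing (𝓞 (Fp L)) (Fp L)) eι (relabelVec (Fp L) ι C w) := fun w => by
    refine Prod.ext rfl ?_
    simp only [relabelVec_apply, reindexW_apply, coe_reindexGL, Matrix.reindex_apply, Matrix.submatrix_mulVec_equiv,
      Equiv.symm_symm, Function.comp_assoc, Equiv.symm_comp_self, Function.comp_id]
  refine Subtype.ext (LinearEquiv.ext fun v => ?_)
  simp only [coe_symplecticGroupCongr_apply, coe_spReindex_apply]
  rw [h1 v, LinearEquiv.symm_apply_apply, h2]

include hdV0 hdW0 in
/-- `det (T_V ⊗ T_W ⊗ 1)` is a unit. [cite: Kudla1984, §1] -/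
theorem isUnit_det_kron :
    IsUnit ((realDiagonal L dV hdV).map (algebraMap (Fp L) (AdeleRing (𝓞 (Fp L)) (Fp L))) ⊗ₖ (realDiagonal L dW hdW).map (algebraMap (Fp L) (AdeleRing (𝓞 (Fp L)) (Fp L)))).det := by
  refine SpTransport.isUnit_det_kronecker ?_ ?_
  · rw [← RingHom.mapMatrix_apply, ← RingHom.map_det]
    exact (isUnit_det_realDiagonal L dV hdV hdV0).map _
  · rw [← RingHom.mapMatrix_apply, ← RingHom.map_det]
    exact (isUnit_det_realDiagonal L dW hdW hdW0).map _

-- (no local notation inside `variable` binders: a notation capturing the section variable `L` elaborates to `sorry` there)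
variable {a : GL (Fin N) (AdeleRing (𝓞 L) L)} {a₀ : GL (Fin N) L}
  (haa₀ : (a : Matrix (Fin N) (Fin N) (AdeleRing (𝓞 L) L)) =
    ((a₀ : GL (Fin N) L) : Matrix (Fin N) (Fin N) L).map (algebraMap L (AdeleRing (𝓞 L) L)))
  (ha : ((a : Matrix (Fin N) (Fin N) (AdeleRing (𝓞 L) L)).map (conjAdele (Fp L) L (IsCMField.complexConj L)))ᵀ *
      adelicForm L N (Matrix.diagonal dV) * a = adelicForm L N (Matrix.diagonal dV'))
  {C : GL (Fin N × Fin M) (AdeleRing (𝓞 (Fp L)) (Fp L))} {C₀ : GL (Fin N × Fin M) (Fp L)}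
  (hCC₀ : (C : Matrix (Fin N × Fin M) (Fin N × Fin M) (AdeleRing (𝓞 (Fp L)) (Fp L))) =
    ((C₀ : GL (Fin N × Fin M) (Fp L)) : Matrix (Fin N × Fin M) (Fin N × Fin M) (Fp L)).map
      (algebraMap (Fp L) (AdeleRing (𝓞 (Fp L)) (Fp L))))
  (hC : (realDiagonal L dV hdV).map (algebraMap (Fp L) (AdeleRing (𝓞 (Fp L)) (Fp L))) ⊗ₖ
        (realDiagonal L dW hdW).map (algebraMap (Fp L) (AdeleRing (𝓞 (Fp L)) (Fp L))) *
      (C : Matrix (Fin N × Fin M) (Fin N × Fin M) (AdeleRing (𝓞 (Fp L)) (Fp L))) =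
    (realDiagonal L dV' hdV').map (algebraMap (Fp L) (AdeleRing (𝓞 (Fp L)) (Fp L))) ⊗ₖ
      (realDiagonal L dW hdW).map (algebraMap (Fp L) (AdeleRing (𝓞 (Fp L)) (Fp L))))

/-- **`r_{L⁺}(h₀)` at the Kronecker index** — Weil's Θ-fixing rational lift of the (T1) see-saw element `h₀ = adelicSeesawConjLeft a C`
(the conjugator of (T3)'s `seesawConjSplittingLeft`; the head's `r_head`). [cite: Weil1964, Chap. III n° 41 Thm 6 p. 193] [cite: GelbartRogawski1991, §3.1 p. 454] -/
def rKron :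
    adelicMpCont (Fp L) (Fin N × Fin M)
      ((realDiagonal L dV hdV).map (algebraMap (Fp L) (AdeleRing (𝓞 (Fp L)) (Fp L))) ⊗ₖ (realDiagonal L dW hdW).map (algebraMap (Fp L) (AdeleRing (𝓞 (Fp L)) (Fp L)))) :=
  ratPointsThetaLiftCont (Fp L) (Fin N × Fin M) _ (isUnit_det_kron L dV hdV hdV0 dW hdW hdW0)
    ⟨adelicSeesawConjLeft (Fp L) L (IsCMField.complexConj L) N M (complexConj_imagUnit L) (imagUnit_ne_zero L)
        (imagUnit_mul_self L) (realDiagonal_isSymm L dV hdV) (realDiagonal_isSymm L dV' hdV') (realDiagonal_isSymm L dW hdW)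
        (realDiagonal_map L dV hdV).symm (realDiagonal_map L dV' hdV').symm (realDiagonal_map L dW hdW).symm a ha C hC,
      adelicSeesawConjLeft_mem_range (Fp L) L (IsCMField.complexConj L) N M (complexConj_imagUnit L) (imagUnit_ne_zero L)
        (imagUnit_mul_self L) (realDiagonal_isSymm L dV hdV) (realDiagonal_isSymm L dV' hdV') (realDiagonal_isSymm L dW hdW)
        (isUnit_det_realDiagonal L dV hdV hdV0) (isUnit_det_realDiagonal L dW hdW hdW0)
        (isUnit_det_kron L dV hdV hdV0 dW hdW hdW0) (realDiagonal_map L dV hdV).symm (realDiagonal_map L dV' hdV').symm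
        (realDiagonal_map L dW hdW).symm haa₀ ha hCC₀ hC⟩

/-- **`r := reindex_e r_{L⁺}(h₀) ∈ Mp(𝕎)ᶜᵒⁿᵗ`** on the datum's index `Fin n` ((T4u)'s conjugator `r`; `(reindex_e)⁻¹ r = rKron` by
`MulEquiv.symm_apply_apply`). [cite: Weil1964, Chap. III n° 41 Thm 6 p. 193] [cite: GelbartRogawski1991, §3.1 p. 454] -/
def r : adelicMpCont (Fp L) (Fin n) (gramA L e dV hdV dW hdW) :=
  adelicMpContReindex (Fp L) e _ (rKron L dV hdV hdV0 dV' hdV' dW hdW hdW0 haa₀ ha hCC₀ hC)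

/-- `(reindex_e)⁻¹ r = rKron`. [cite: MoeglinVignerasWaldspurger1987, Chap. 2 II.1] -/
theorem adelicMpContReindex_symm_r :
    (adelicMpContReindex (Fp L) e _).symm (r L e dV hdV hdV0 dV' hdV' dW hdW hdW0 haa₀ ha hCC₀ hC) =
      rKron L dV hdV hdV0 dV' hdV' dW hdW hdW0 haa₀ ha hCC₀ hC :=
  (adelicMpContReindex (Fp L) e _).symm_apply_apply _

/-- `π(r) = spReindex_e h₀`. [cite: Weil1964, Chap. III n° 40 p. 190] -/
theorem proj_r :
    adelicMpCont.proj (Fp L) (Fin n) (gramA L e dV hdV dW hdW) (r L e dV hdV hdV0 dV' hdV' dW hdW hdW0 haa₀ ha hCC₀ hC) =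
      spReindex e _
        (adelicSeesawConjLeft (Fp L) L (IsCMField.complexConj L) N M (complexConj_imagUnit L) (imagUnit_ne_zero L)
          (imagUnit_mul_self L) (realDiagonal_isSymm L dV hdV) (realDiagonal_isSymm L dV' hdV') (realDiagonal_isSymm L dW hdW)
          (realDiagonal_map L dV hdV).symm (realDiagonal_map L dV' hdV').symm (realDiagonal_map L dW hdW).symm a ha C hC) := by
  show adelicMpCont.proj (Fp L) (Fin n) _ (adelicMpContReindex (Fp L) e _ _) = _
  rw [adelicMpCont.proj_reindex]
  exact congrArg _ (proj_ratPointsThetaLiftCont (Fp L) (Fin N × Fin M) _ _ _)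

/-- `r` is Θ-fixing ((T4u) §B `hθ₁`). [cite: Weil1964, Chap. III n° 41 Thm 6 p. 193] -/
theorem r_mem_adelicMpTheta :
    ((r L e dV hdV hdV0 dV' hdV' dW hdW hdW0 haa₀ ha hCC₀ hC : adelicMpCont (Fp L) (Fin n) (gramA L e dV hdV dW hdW)) :
        adelicMp (Fp L) (Fin n) (gramA L e dV hdV dW hdW)) ∈ adelicMpTheta (Fp L) (Fin n) (gramA L e dV hdV dW hdW) :=
  (coe_adelicMpContReindex_mem_adelicMpTheta_iff (Fp L) e _ _).2
    (coe_ratPointsThetaLiftCont_mem_adelicMpTheta (Fp L) (Fin N × Fin M) _ _ _)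

/-- **(T4u)'s `hsq` IN THE MODEL, TOKEN FOR TOKEN**: `π(r) · Congr_{Λ_{relabC}}(ι′ g′) · π(r)⁻¹ = ι((a ⊗ 1) g′ (a ⊗ 1)⁻¹)` with the datum's
`ι = D.toSp = spReindex_e ∘ adelicPairToSymplectic` ((T3) `adelicSeesawConjLeft_conj_pair`, re-enumerated). [cite: Kudla1984, §1] -/
theorem r_square (g' : adelicPair (Fp L) L (IsCMField.complexConj L) N M (Matrix.diagonal dV') (Matrix.diagonal dW)) :
    adelicMpCont.proj (Fp L) (Fin n) (gramA L e dV hdV dW hdW) (r L e dV hdV hdV0 dV' hdV' dW hdW hdW0 haa₀ ha hCC₀ hC) *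
        symplecticGroupCongr (polar (adelicForm (Fp L) (Fin n) (gramA L e dV' hdV' dW hdW)))
          (polar (adelicForm (Fp L) (Fin n) (gramA L e dV hdV dW hdW)))
          (relabelVec (Fp L) (Fin n) (relabC e C))
          (polar_relabelVec (Fp L) (Fin n) (relabC e C) (gramA_mul_relabC L e dV hdV dV' hdV' dW hdW C hC))
          ((D L e dV' hdV' hdV'0 dW hdW hdW0).toSp g') *
      (adelicMpCont.proj (Fp L) (Fin n) (gramA L e dV hdV dW hdW) (r L e dV hdV hdV0 dV' hdV' dW hdW hdW0 haa₀ ha hCC₀ hC))⁻¹ =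
    (D L e dV hdV hdV0 dW hdW hdW0).toSp (adelicPairIsometryConjLeft (Fp L) L (IsCMField.complexConj L) N M a ha g') := by
  have H1 := proj_r L e dV hdV hdV0 dV' hdV' dW hdW hdW0 haa₀ ha hCC₀ hC
  -- the relabelling conjugate of `ι′ g′` read at the Kronecker index (`D.toSp = spReindex_e ∘ adelicPairToSymplectic`, `rfl`)
  have H2 : symplecticGroupCongr (polar (adelicForm (Fp L) (Fin n) (gramA L e dV' hdV' dW hdW)))
        (polar (adelicForm (Fp L) (Fin n) (gramA L e dV hdV dW hdW))) (relabelVec (Fp L) (Fin n) (relabC e C))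
        (polar_relabelVec (Fp L) (Fin n) (relabC e C) (gramA_mul_relabC L e dV hdV dV' hdV' dW hdW C hC))
        ((D L e dV' hdV' hdV'0 dW hdW hdW0).toSp g') =
      spReindex e _
        (symplecticGroupCongr _ _ (relabelVec (Fp L) (Fin N × Fin M) C) (polar_relabelVec (Fp L) (Fin N × Fin M) C hC)
          (adelicPairToSymplectic (Fp L) L (IsCMField.complexConj L) N M (complexConj_imagUnit L) (imagUnit_ne_zero L)
            (imagUnit_mul_self L) (realDiagonal_isSymm L dV' hdV') (realDiagonal_isSymm L dW hdW)
            (realDiagonal_map L dV' hdV').symm (realDiagonal_map L dW hdW).symm g')) :=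
    symplecticGroupCongr_relabelVec_spReindex L e C hC
      (by rw [← relabC_def]; exact gramA_mul_relabC L e dV hdV dV' hdV' dW hdW C hC) _
  -- the (T1)/(T3) square at the Kronecker index, pushed through `spReindex_e`
  have H3 := (map_mul_mul_inv_eq (spReindex e
      ((realDiagonal L dV hdV).map (algebraMap (Fp L) (AdeleRing (𝓞 (Fp L)) (Fp L))) ⊗ₖ (realDiagonal L dW hdW).map (algebraMap (Fp L) (AdeleRing (𝓞 (Fp L)) (Fp L))))) _ _).trans
    (congrArg (spReindex e
      ((realDiagonal L dV hdV).map (algebraMap (Fp L) (AdeleRing (𝓞 (Fp L)) (Fp L))) ⊗ₖ (realDiagonal L dW hdW).map (algebraMap (Fp L) (AdeleRing (𝓞 (Fp L)) (Fp L)))))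
      (adelicSeesawConjLeft_conj_pair (Fp L) L (IsCMField.complexConj L) N M (complexConj_imagUnit L) (imagUnit_ne_zero L)
        (imagUnit_mul_self L) (realDiagonal_isSymm L dV hdV) (realDiagonal_isSymm L dV' hdV') (realDiagonal_isSymm L dW hdW)
        (realDiagonal_map L dV hdV).symm (realDiagonal_map L dV' hdV').symm (realDiagonal_map L dW hdW).symm a ha C hC g'))
  -- (no `rw` on this goal: abstracting over the datum's `toSp` telescope times out; congruences are threaded by hand)
  exact (congrArg₂ (fun P X : symplecticGroup (polar (adelicForm (Fp L) (Fin n) (gramA L e dV hdV dW hdW))) => P * X * P⁻¹)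
    H1 H2).trans H3

/-! ### `rneg` on `𝕎⁻` (Gram `−gramA`) and (T4u) §B's `hπ` -/

/-- `gramA` is symmetric. [cite: GelbartRogawski1991, §3.1 p. 454] -/
theorem gramA_isSymm' : (gramA L e dV hdV dW hdW).IsSymm := by
  show (Matrix.reindex e e _).IsSymm
  exact (isSymm_kronecker ((realDiagonal_isSymm L dV hdV).map _) ((realDiagonal_isSymm L dW hdW).map _)).submatrix _

-- (`gramR` symmetric / `det gramR` a unit are ★ `gramR_isSymm` [`DoubledWeilRepresentationLocalFamilyCM`] and ★ `isUnit_det_gramR₀`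
-- [`DoubledWeilRepresentationArchLagrangian`]; the phase-A copies are dropped for them — gate `dedup.landed`.)

/-- **`reindex_e (J_V ⊗ J_W)_𝔸 = gramA ⊗ 1`**: the `Fin n`-indexed adelic hermitian form is the base change of the datum's Gram matrix.
[cite: GelbartRogawski1991, §3.1 Prop. 3.1.1 p. 455 L1–2] -/
theorem reindex_pairFormA_eq :
    Matrix.reindex e e (pairFormA L dV dW) = (gramA L e dV hdV dW hdW).map (AdeleRing.baseChange (Fp L) L) := by
  show _ = (Matrix.reindex e e _).map _
  rw [reindex_map, ← kronecker_map_map, ← adelicForm_eq_map_map L N (realDiagonal L dV hdV) (realDiagonal_map L dV hdV).symm,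
    ← adelicForm_eq_map_map L M (realDiagonal L dW hdW) (realDiagonal_map L dW hdW).symm]

/-- **`h₀⁻ := Res(reindex_e (a ⊗ 1)) ∘ Λ_{C̃}⁻¹ ∈ Sp(𝕎⁻)(𝔸_{L⁺})`**, the see-saw element for the NEGATED forms (`−gramA`, `−reindex_e(J_V ⊗ J_W)`):
same matrices, isometry and relabelling identities negated. [cite: Kudla1984, §1] [cite: Kudla1994, §2 (doubled space, Siegel parabolic), Thm. 3.1] -/
def seesawNeg (a : GL (Fin N) (AdeleRing (𝓞 L) L))
    (ha : ((a : Matrix (Fin N) (Fin N) (AdeleRing (𝓞 L) L)).map (conjAdele (Fp L) L (IsCMField.complexConj L)))ᵀ *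
        adelicForm L N (Matrix.diagonal dV) * a = adelicForm L N (Matrix.diagonal dV'))
    (C : GL (Fin N × Fin M) (AdeleRing (𝓞 (Fp L)) (Fp L)))
    (hC : (realDiagonal L dV hdV).map (algebraMap (Fp L) (AdeleRing (𝓞 (Fp L)) (Fp L))) ⊗ₖ (realDiagonal L dW hdW).map (algebraMap (Fp L) (AdeleRing (𝓞 (Fp L)) (Fp L))) *
        (C : Matrix (Fin N × Fin M) (Fin N × Fin M) (AdeleRing (𝓞 (Fp L)) (Fp L))) =
      (realDiagonal L dV' hdV').map (algebraMap (Fp L) (AdeleRing (𝓞 (Fp L)) (Fp L))) ⊗ₖ (realDiagonal L dW hdW).map (algebraMap (Fp L) (AdeleRing (𝓞 (Fp L)) (Fp L)))) :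
    symplecticGroup (polar (adelicForm (Fp L) (Fin n) (-gramA L e dV hdV dW hdW))) :=
  (qc L).seesawConj (Fin n) (gramA_isSymm' L e dV hdV dW hdW).neg (gramA_isSymm' L e dV' hdV' dW hdW).neg
    (σ := conjAdele (Fp L) L (IsCMField.complexConj L)) (fun x => by rw [conjAdele_apply, AdeleRing.smul_baseChange])
    (by rw [← algebraMap_conj, RingHom.coe_coe, complexConj_imagUnit L, map_neg])
    (H := -Matrix.reindex e e (pairFormA L dV dW)) (H' := -Matrix.reindex e e (pairFormA L dV' dW))
    (by rw [Matrix.map_neg _ (map_neg _), ← reindex_pairFormA_eq])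
    (by rw [Matrix.map_neg _ (map_neg _), ← reindex_pairFormA_eq])
    (kronA e a) (isometry_neg _ (kronA_isometry L e dV dV' dW a ha)) (relabC e C)
    (by rw [Matrix.neg_mul, gramA_mul_relabC L e dV hdV dV' hdV' dW hdW C hC])

include hdV0 hdW0 haa₀ hCC₀ in
/-- `h₀⁻` of rational data is `L⁺`-rational (★ `seesawConj_adele_mem_range` at `T₀ = −gramR`). [cite: Weil1964, Chap. III n° 41 Thm 6 p. 193] -/
theorem seesawNeg_mem_range :
    seesawNeg L e dV hdV dV' hdV' dW hdW a ha C hC ∈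
      ((transportSp (-gramA L e dV hdV dW hdW) (isUnit_det_neg (isUnit_det_gramA L e dV hdV hdV0 dW hdW hdW0))).comp
        (mapHom (algebraMap (Fp L) (AdeleRing (𝓞 (Fp L)) (Fp L))))).range :=
  seesawConj_adele_mem_range (Fp L) L (IsCMField.complexConj L) (complexConj_imagUnit L) (imagUnit_ne_zero L)
    (imagUnit_mul_self L) (gramR_isSymm L e dV hdV dW hdW).neg (gramR_isSymm L e dV' hdV' dW hdW).neg
    (isUnit_det_neg (isUnit_det_gramR₀ L e dV hdV hdV0 dW hdW hdW0))
    (by rw [Matrix.map_neg _ (map_neg _), ← gramA_eq_map]) (by rw [Matrix.map_neg _ (map_neg _), ← gramA_eq_map])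
    (gramA_isSymm' L e dV hdV dW hdW).neg (gramA_isSymm' L e dV' hdV' dW hdW).neg
    (isUnit_det_neg (isUnit_det_gramA L e dV hdV hdV0 dW hdW hdW0))
    (H := -Matrix.reindex e e (pairFormA L dV dW)) (H' := -Matrix.reindex e e (pairFormA L dV' dW))
    (by rw [Matrix.map_neg _ (map_neg _), ← reindex_pairFormA_eq])
    (by rw [Matrix.map_neg _ (map_neg _), ← reindex_pairFormA_eq])
    (g₀ := kronA e a₀) (coe_kronA_map e (algebraMap L (AdeleRing (𝓞 L) L)) a₀ haa₀) (isometry_neg _ (kronA_isometry L e dV dV' dW a ha))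
    (C₀ := relabC e C₀) (coe_relabC_map e (algebraMap (Fp L) (AdeleRing (𝓞 (Fp L)) (Fp L))) C₀ hCC₀)
    (by rw [Matrix.neg_mul, gramA_mul_relabC L e dV hdV dV' hdV' dW hdW C hC])

/-- **`r⁻ := r_{L⁺}(h₀⁻) ∈ Mp(𝕎⁻)ᶜᵒⁿᵗ`** ((T4u) §B's `rneg`; `ω(r⁻)` is the `B` of (T4u)'s `hrD`). [cite: Weil1964, Chap. III n° 41 Thm 6 p. 193] -/
def rneg : adelicMpCont (Fp L) (Fin n) (-gramA L e dV hdV dW hdW) :=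
  ratPointsThetaLiftCont (Fp L) (Fin n) (-gramA L e dV hdV dW hdW) (isUnit_det_neg (isUnit_det_gramA L e dV hdV hdV0 dW hdW hdW0))
    ⟨seesawNeg L e dV hdV dV' hdV' dW hdW a ha C hC, seesawNeg_mem_range L e dV hdV hdV0 dV' hdV' dW hdW hdW0 haa₀ ha hCC₀ hC⟩

/-- `π(r⁻) = h₀⁻`. [cite: Weil1964, Chap. III n° 40 p. 190] -/
theorem proj_rneg :
    adelicMpCont.proj (Fp L) (Fin n) (-gramA L e dV hdV dW hdW) (rneg L e dV hdV hdV0 dV' hdV' dW hdW hdW0 haa₀ ha hCC₀ hC) =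
      seesawNeg L e dV hdV dV' hdV' dW hdW a ha C hC :=
  proj_ratPointsThetaLiftCont (Fp L) (Fin n) _ _ _

/-- `r⁻` is Θ-fixing ((T4u) §B `hθ₂`). [cite: Weil1964, Chap. III n° 41 Thm 6 p. 193] -/
theorem rneg_mem_adelicMpTheta :
    ((rneg L e dV hdV hdV0 dV' hdV' dW hdW hdW0 haa₀ ha hCC₀ hC : adelicMpCont (Fp L) (Fin n) (-gramA L e dV hdV dW hdW)) :
        adelicMp (Fp L) (Fin n) (-gramA L e dV hdV dW hdW)) ∈ adelicMpTheta (Fp L) (Fin n) (-gramA L e dV hdV dW hdW) :=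
  coe_ratPointsThetaLiftCont_mem_adelicMpTheta (Fp L) (Fin n) _ _ _

omit [IsCMField L] in
/-- `Λ_{C̃}⁻¹` in coordinates: `C̃⁻¹ y = e_* (C⁻¹ (e^* y))`. [cite: MoeglinVignerasWaldspurger1987, Chap. 2 II.1] -/
theorem relabC_inv_mulVec (C : GL (Fin N × Fin M) (AdeleRing (𝓞 (Fp L)) (Fp L))) (y : Fin n → (AdeleRing (𝓞 (Fp L)) (Fp L))) :
    (((relabC e C)⁻¹ : GL (Fin n) (AdeleRing (𝓞 (Fp L)) (Fp L))) : Matrix (Fin n) (Fin n) (AdeleRing (𝓞 (Fp L)) (Fp L))) *ᵥ y =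
      ((((C⁻¹ : GL (Fin N × Fin M) (AdeleRing (𝓞 (Fp L)) (Fp L))) : Matrix (Fin N × Fin M) (Fin N × Fin M) (AdeleRing (𝓞 (Fp L)) (Fp L))) *ᵥ (y ∘ e)) ∘ e.symm) := by
  rw [relabC_def, ← map_inv, coe_reindexGL, Matrix.reindex_apply, Matrix.submatrix_mulVec_equiv, Equiv.symm_symm]

omit [IsCMField L] in
/-- `Λ_{C^𝔻}⁻¹` in coordinates: block-diagonal `C̃⁻¹ ⊕ C̃⁻¹` read through `e₂`. [cite: MoeglinVignerasWaldspurger1987, Chap. 2 II.1] -/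
theorem relabCD_inv_mulVec (C : GL (Fin N × Fin M) (AdeleRing (𝓞 (Fp L)) (Fp L))) (y : Fin (n + n) → (AdeleRing (𝓞 (Fp L)) (Fp L))) :
    (((relabCD e C)⁻¹ : GL (Fin (n + n)) (AdeleRing (𝓞 (Fp L)) (Fp L))) : Matrix (Fin (n + n)) (Fin (n + n)) (AdeleRing (𝓞 (Fp L)) (Fp L))) *ᵥ y =
      (Sum.elim ((((relabC e C)⁻¹ : GL (Fin n) (AdeleRing (𝓞 (Fp L)) (Fp L))) : Matrix (Fin n) (Fin n) (AdeleRing (𝓞 (Fp L)) (Fp L))) *ᵥ ((y ∘ e₂ (n := n)) ∘ Sum.inl))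
          ((((relabC e C)⁻¹ : GL (Fin n) (AdeleRing (𝓞 (Fp L)) (Fp L))) : Matrix (Fin n) (Fin n) (AdeleRing (𝓞 (Fp L)) (Fp L))) *ᵥ ((y ∘ e₂ (n := n)) ∘ Sum.inr))) ∘
        (e₂ (n := n)).symm := by
  rw [relabCD_def, ← map_inv, ← map_inv, Prod.inv_mk, coe_reindexGL, coe_blockDiagGL, Matrix.reindex_apply,
    Matrix.submatrix_mulVec_equiv, Equiv.symm_symm, Matrix.fromBlocks_mulVec, Matrix.zero_mulVec, Matrix.zero_mulVec, add_zero,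
    zero_add]

/-- `π(r)` in coordinates: `π(r)(x, y) = Res(kronA)(x, C̃⁻¹ y)` — the same formula as `π(r⁻)`. [cite: Kudla1984, §1] -/
theorem coe_proj_r_apply (x y : Fin n → (AdeleRing (𝓞 (Fp L)) (Fp L))) :
    (adelicMpCont.proj (Fp L) (Fin n) (gramA L e dV hdV dW hdW) (r L e dV hdV hdV0 dV' hdV' dW hdW hdW0 haa₀ ha hCC₀ hC)).1 (x, y) =
      (qc L).resAut (Fin n) (kronA e a) (x, (((relabC e C)⁻¹ : GL (Fin n) (AdeleRing (𝓞 (Fp L)) (Fp L))) : Matrix (Fin n) (Fin n) (AdeleRing (𝓞 (Fp L)) (Fp L))) *ᵥ y) := by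
  rw [proj_r, coe_spReindex_apply, coe_adelicSeesawConjLeft, LinearEquiv.trans_apply, relabelEquiv_symm_apply,
    reindexW_symm_apply, kronA_def, (qc L).resAut_reindexGL, LinearEquiv.trans_apply, LinearEquiv.trans_apply,
    reindexW_symm_apply, relabC_inv_mulVec]
  simp only [Function.comp_assoc, Equiv.symm_comp_self, Function.comp_id]

/-- `π(r⁻)` in coordinates. [cite: Kudla1984, §1] -/
theorem coe_proj_rneg_apply (x y : Fin n → (AdeleRing (𝓞 (Fp L)) (Fp L))) :
    (adelicMpCont.proj (Fp L) (Fin n) (-gramA L e dV hdV dW hdW) (rneg L e dV hdV hdV0 dV' hdV' dW hdW hdW0 haa₀ ha hCC₀ hC)).1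
        (x, y) =
      (qc L).resAut (Fin n) (kronA e a) (x, (((relabC e C)⁻¹ : GL (Fin n) (AdeleRing (𝓞 (Fp L)) (Fp L))) : Matrix (Fin n) (Fin n) (AdeleRing (𝓞 (Fp L)) (Fp L))) *ᵥ y) := by
  rw [proj_rneg]; rfl

/-- `π(r^𝔻)` in coordinates. [cite: Kudla1984, §1] -/
theorem coe_projD_rD_apply (x y : Fin (n + n) → (AdeleRing (𝓞 (Fp L)) (Fp L))) :
    (projD L e dV hdV dW hdW (rD L e dV hdV hdV0 dV' hdV' dW hdW hdW0 haa₀ ha hCC₀ hC)).1 (x, y) =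
      (qc L).resAut (Fin (n + n)) (kronAD e a)
        (x, (((relabCD e C)⁻¹ : GL (Fin (n + n)) (AdeleRing (𝓞 (Fp L)) (Fp L))) : Matrix (Fin (n + n)) (Fin (n + n)) (AdeleRing (𝓞 (Fp L)) (Fp L))) *ᵥ y) := by
  rw [projD_rD]; rfl

/-- **(T4u) §B's `hπ` IN THE MODEL, TOKEN FOR TOKEN**: `π(undoubleIdx r^𝔻) = π(r) ⊕ π(r⁻)` in `Sp(𝕎 ⊕ 𝕎⁻)(𝔸)` —
`Res((ã ⊕ ã)) ∘ Λ_{C̃ ⊕ C̃}⁻¹` read on `Fin n ⊕ Fin n` is `(Res ã ∘ Λ_{C̃}⁻¹) ⊕ (Res ã ∘ Λ_{C̃}⁻¹)`.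
[cite: Kudla1984, §1] [cite: Kudla1994, §2 (doubled space, Siegel parabolic), Thm. 3.1] -/
theorem proj_undoubleIdx_rD :
    adelicMpCont.proj (Fp L) (Fin n ⊕ Fin n) (gramS L e dV hdV dW hdW)
        (undoubleIdx L e dV hdV dW hdW (rD L e dV hdV hdV0 dV' hdV' dW hdW hdW0 haa₀ ha hCC₀ hC)) =
      spSum (gramA L e dV hdV dW hdW) (-gramA L e dV hdV dW hdW)
        (adelicMpCont.proj (Fp L) (Fin n) (gramA L e dV hdV dW hdW) (r L e dV hdV hdV0 dV' hdV' dW hdW hdW0 haa₀ ha hCC₀ hC),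
          adelicMpCont.proj (Fp L) (Fin n) (-gramA L e dV hdV dW hdW) (rneg L e dV hdV hdV0 dV' hdV' dW hdW hdW0 haa₀ ha hCC₀ hC)) := by
  -- (all rewrites fully instantiated: `rw` with open patterns over this goal runs into the `isDefEq` heartbeat cliff)
  refine Subtype.ext (LinearEquiv.ext fun w => ?_)
  refine (proj_undoubleIdx_apply (L := L) (e := e) (dV := dV) (hdV := hdV) (dW := dW) (hdW := hdW)
    (rD L e dV hdV hdV0 dV' hdV' dW hdW hdW0 haa₀ ha hCC₀ hC) w).trans ?_
  refine Eq.trans ?_ (spSumEquiv_apply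
    (adelicMpCont.proj (Fp L) (Fin n) (gramA L e dV hdV dW hdW) (r L e dV hdV hdV0 dV' hdV' dW hdW hdW0 haa₀ ha hCC₀ hC)).1
    (adelicMpCont.proj (Fp L) (Fin n) (-gramA L e dV hdV dW hdW) (rneg L e dV hdV hdV0 dV' hdV' dW hdW hdW0 haa₀ ha hCC₀ hC)).1
    w).symm
  -- (`simp only`, not `rw`: keyed matching at reducible transparency never compares the two symplectic groups by unfolding)
  simp only [coe_projD_rD_apply L e dV hdV hdV0 dV' hdV' dW hdW hdW0 haa₀ ha hCC₀ hC,
    coe_proj_r_apply L e dV hdV hdV0 dV' hdV' dW hdW hdW0 haa₀ ha hCC₀ hC,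
    coe_proj_rneg_apply L e dV hdV hdV0 dV' hdV' dW hdW hdW0 haa₀ ha hCC₀ hC, kronAD_def, (qc L).resAut_reindexGL,
    LinearEquiv.trans_apply, (qc L).resAut_blockDiagGL, reindexW_symm_apply, spSumEquiv_apply, reindexW_apply,
    relabCD_inv_mulVec, Function.comp_def, Sum.elim_inl, Sum.elim_inr, Equiv.symm_apply_apply]

end Undoubled

end Literature.NumberTheory.GelbartRogawski1991.GRConstruction

end
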